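import Summits.KontsevichZagierPeriods.KontsevichZagierPeriods.Theorems.RootDecompRationalCubeDichotomyEtalePoleBox

/-!
# Route RootDecompRationalCubeDichotomy — items 29429 `PiRationalisationEtale` / 29431 `PiRationalisationGlue` PROVED, part 7/8: ROUTE ITEM 29429 `PiRationalisationEtale` PROVED BY NAME (`piRationalisationEtale_proof`) (`RootDecompRationalCubeDichotomyPiRationalisationEtale`)

Theorems-split (≤ 400 lines each, sequential imports) of the decomp-kz lens-2 gen-5 file
`run/shared/lean/pub/decomp-kz/decomp-kz-lens-2/g5/PiRationalisationEtale.lean` (sha256 204f4992…, 2557 lines; lens farm rc 0 / 0 sorry /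
std axioms; critic decomp-kz-crit-1 g2 CLEARED/CONFIRMED 2026-08-30T06:50:50Z «29429 + 29431 proved BY NAME»), landed by the census seat
decomp-kz-census-1 g6 with the 86 verbatim copies of already-landed declarations REMOVED in favour of `import`/`open` of the landed
`Rung27842.ReIm` / `Rung27842.SimpleBranch` / `Rung24903` chain (`ratCubeSet`, `piIter_mem_sup`, `RatBoxSet`, `BoxRescale`, `boxRescale_holds`,
the Re–Im polynomial calculus, the Green assembly kit, the S3/S1 lemmas), so that only the NEW weighted (étale) content is declared here.
The rung: for WEIGHTED simple-branch (standard-étale) data `[Π[loᵢ,hiᵢ], A(x,h x)/B(x,h x)]` (`F(x,h) = 0`, `∂_w F(x,h) ≠ 0`, `B(x,h) ≠ 0` on the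
closed box, `F A B ∈ ℚ[x,w]`, `h` ℚ-Nash near the box) `[π]^K·[s] ∈ relations ⊔ ⟨rational closed-cube sector⟩` for every `K ≥ 1` — the gen-4
argument-principle chain with the contour form `ω = A·F_w/(B·F) dw`, whose residue at the simple real root is `A/B = s.integrand`.
[Kontsevich–Zagier 2001 §1.2; argument principle] Standard axioms, 0 sorry.
-/

noncomputable section

set_option linter.dupNamespace false

namespace Summit.KontsevichZagierPeriods.RootDecompRationalCubeDichotomy.RungEtale.Etale

open MeasureTheory Set MvPolynomial
open Literature.NumberTheory.Transcendental Literature.NumberTheory.Transcendental.KZ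
open Literature.ModelTheory.ExponentialFields (IsSemialgebraic analyticOnNhd_aeval continuous_aeval_real)
open Summit.KontsevichZagierPeriods.KontsevichZagierPeriods.Theses.RootDecompRationalCubeDichotomy
open Summit.KontsevichZagierPeriods.RootDecompRationalCubeDichotomy.Rung24903 (of_sub_of_mem_relations_of_fibreMap)
open Summit.KontsevichZagierPeriods.RootDecompRationalCubeDichotomy.Rung27842
open Summit.KontsevichZagierPeriods.RootDecompRationalCubeDichotomy.Rung27842.RootIso
open Summit.KontsevichZagierPeriods.RootDecompRationalCubeDichotomy.Rung27842.SimpleBranch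
open Summit.KontsevichZagierPeriods.RootDecompRationalCubeDichotomy.Rung24903
  (piRep_mul_mem_sup_of_mem_closure piRep_mul_mem_sup piIter_mem_sup isSemialgebraic_cubeLit)

/-- **Item stmt-KontsevichZagierPeriods-29429 `PiRationalisationEtale` HOLDS** (route decl BY NAME; gen 5; standard
axioms, 0 sorry): for a rational box `Π[loᵢ,hiᵢ] ⊆ U` and standard-étale data — `h` ℚ-Nash on `U`, `F A B ∈ ℚ[x,w]`
with `F(x,h x) = 0`, `∂_w F(x,h x) ≠ 0`, `B(x,h x) ≠ 0` on the box — every representation `[box, A(x,h x)/B(x,h x)]`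
has `[π]^K·[s] ∈ relations ⊔ ⟨rational closed-cube sector⟩` for all `K ≥ 1`. Box → cube by ONE affine change of
variables (the étale data transported by `xSubst`), then `etale_cube`. -/
theorem piRationalisationEtale_proof :
    Summit.KontsevichZagierPeriods.KontsevichZagierPeriods.Theses.RootDecompRationalCubeDichotomy.PiRationalisationEtale := by
  intro n h U s F A B lo hi hU hlohi hsd hsU hhs hha hF0 hFw hB hint
  classical
  -- rescaling data
  set d : Fin n → ℚ := fun j => hi j - lo j with hd
  have hdpos : ∀ j, (0:ℝ) < (d j : ℝ) := fun j => by
    have := hlohi j; rw [hd]; exact_mod_cast sub_pos.2 this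
  set Φ : (Fin n → ℝ) → (Fin n → ℝ) := boxMap (fun j => (lo j : ℝ)) (fun j => (d j : ℝ)) with hΦ
  set C0 : Set (Fin n → ℝ) := Set.pi Set.univ (fun _ : Fin n => Set.Icc (0:ℝ) 1) with hC0
  have hC0sa : IsSemialgebraic ℚ C0 := isSemialgebraic_cubeLit n
  have hC0c : IsCompact C0 := isCompact_univ_pi fun _ => isCompact_Icc
  have himage : Φ '' C0 = s.domain := by
    rw [hΦ, hC0, image_boxMap_cube _ _ hdpos, hsd]
    congr 1; funext j
    rw [hd]; push_cast; congr 1; ring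
  have hmaps : ∀ t ∈ C0, Φ t ∈ s.domain := fun t ht => himage ▸ Set.mem_image_of_mem Φ ht
  -- transported branch `h' = h ∘ Φ` on `U' = Φ⁻¹ U`
  set U' : Set (Fin n → ℝ) := Φ ⁻¹' U with hU'
  have hU'open : IsOpen U' := hU.preimage (continuous_boxMap _ _)
  have hC0U' : C0 ⊆ U' := fun t ht => hsU (hmaps t ht)
  set h' : (Fin n → ℝ) → ℝ := fun t => h (Φ t) with hh'
  have hh'sa : IsSemialgebraicFunOn ℚ U' h' := by
    have h1 := hhs.comp_aeval (fun j : Fin n => (C (lo j) + C (d j) * X j : MvPolynomial (Fin n) ℚ))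
    rw [aevalMap_eq_boxMap] at h1
    refine h1.congr fun x _ => ?_
    have hx : (fun j : Fin n => aeval x (C (lo j) + C (d j) * X j : MvPolynomial (Fin n) ℚ)) = Φ x :=
      congr_fun (aevalMap_eq_boxMap lo d) x
    simp only [hx, hh']
  have hh'an : AnalyticOnNhd ℝ h' U' := fun t ht => (hha (Φ t) ht).comp (analyticAt_boxMap _ _ t)
  have hU'sa : IsSemialgebraic ℚ U' := IsSemialgebraicFunOn.isSemialgebraic_holds hh'sa
  -- transported polynomials
  set vol : ℚ := ∏ j, d j with hvol
  set F' : MvPolynomial (Fin (n + 1)) ℚ := bind₁ (xSubst n lo d) F with hF'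
  set A' : MvPolynomial (Fin (n + 1)) ℚ := C vol * bind₁ (xSubst n lo d) A with hA'
  set B' : MvPolynomial (Fin (n + 1)) ℚ := bind₁ (xSubst n lo d) B with hB'
  have key : ∀ (t : Fin n → ℝ) (P : MvPolynomial (Fin (n + 1)) ℚ),
      aeval (Fin.snoc t (h' t) : Fin (n + 1) → ℝ) (bind₁ (xSubst n lo d) P) =
        aeval (Fin.snoc (Φ t) (h (Φ t)) : Fin (n + 1) → ℝ) P := fun t P => by
    rw [hh', hΦ]; exact aeval_bind₁_xSubst lo d t (h (boxMap (fun j => (lo j : ℝ)) (fun j => (d j : ℝ)) t)) P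
  have hF'0 : ∀ t ∈ C0, aeval (Fin.snoc t (h' t) : Fin (n + 1) → ℝ) F' = 0 := fun t ht => by
    rw [hF', key]; exact hF0 _ (hmaps t ht)
  have hF'w : ∀ t ∈ C0, aeval (Fin.snoc t (h' t) : Fin (n + 1) → ℝ) (pderiv (Fin.last n) F') ≠ 0 := fun t ht => by
    rw [hF', pderiv_last_bind₁_xSubst, key]; exact hFw _ (hmaps t ht)
  have hB'0 : ∀ t ∈ C0, aeval (Fin.snoc t (h' t) : Fin (n + 1) → ℝ) B' ≠ 0 := fun t ht => by
    rw [hB', key]; exact hB _ (hmaps t ht)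
  have hB'U : ∀ t ∈ U', aeval (Fin.snoc t (h' t) : Fin (n + 1) → ℝ) B' ≠ 0 ∨ True := fun _ _ => Or.inr trivial
  -- the cube representation `q' = [C0, A'(t,h' t)/B'(t,h' t)]`
  set g' : (Fin n → ℝ) → ℝ := fun t =>
    aeval (Fin.snoc t (h' t) : Fin (n + 1) → ℝ) A' / aeval (Fin.snoc t (h' t) : Fin (n + 1) → ℝ) B' with hg'
  have hg'sa : IsSemialgebraicFunOn ℚ C0 g' :=
    IsSemialgebraicFunOn.comp_isSemialgebraicMapOn_holds
      (isSemialgebraicFunOn_aeval_div_aeval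
        (Literature.ModelTheory.ExponentialFields.isSemialgebraic_setOf_eval_ne_zero (k := ℚ) (R := ℝ) B') A' B'
        (fun _ hy => hy))
      (isSemialgebraicMapOn_graphMap hC0sa (hh'sa.mono hC0U' hC0sa)) (fun t ht => hB'0 t ht)
  have hιc : ContinuousOn (fun t : Fin n → ℝ => (Fin.snoc t (h' t) : Fin (n + 1) → ℝ)) C0 :=
    continuousOn_graphMap (hh'an.continuousOn.mono hC0U')
  have hg'c : ContinuousOn g' C0 :=
    ((continuous_aeval_real (k := ℚ) A').comp_continuousOn hιc).div
      ((continuous_aeval_real (k := ℚ) B').comp_continuousOn hιc) hB'0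
  let q' : IntegralRep n := cRep C0 hC0sa hC0c g' hg'sa hg'c
  -- the Jacobian and the change of variables `[q'] − [s] ∈ relations`
  have hdet : |(diagCLM (fun j => (d j : ℝ))).det| = ((∏ j, d j : ℚ) : ℝ) := by
    rw [det_diagCLM, abs_of_pos (Finset.prod_pos fun j _ => hdpos j)]
    push_cast; rfl
  have hrel : of q' - of s ∈ relations := by
    refine changeOfVariablesRel_subset_relations
      ⟨n, q', s, Φ, fun _ => diagCLM (fun j => (d j : ℝ)), ?_, fun t _ => ?_, ?_, himage.symm, fun t ht => ?_, rfl⟩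
    · exact isSemialgebraicMapOn_boxMap lo d hC0sa
    · exact hasFDerivWithinAt_boxMap _ _ _ _
    · exact injOn_boxMap _ _ (fun j => (hdpos j).ne') _
    · show g' t = s.integrand (Φ t) * _
      rw [hdet, hint _ (hmaps t ht), hg']
      simp only [hA', hB', map_mul, MvPolynomial.aeval_C, key, eq_ratCast, hvol]
      ring
  -- the weighted chain on the cube representation
  have hcube := etale_cube rootIsolationE_holds boxChainE_holds n h' U' q' F' A' B' hU'open hC0U' hh'sa hh'an
    hF'0 hF'w hB'0 rfl (fun t _ => rfl)
  refine ⟨1, fun K hK => ?_⟩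
  have hsplit : of s = (of s - of q') + of q' := by abel
  rw [hsplit, piIter_add]
  refine add_mem (AddSubgroup.mem_sup_left (piRep_mul_iterate_mem_relations _ ?_)) (hcube K hK)
  have hneg := neg_mem hrel
  rwa [neg_sub] at hneg

end Summit.KontsevichZagierPeriods.RootDecompRationalCubeDichotomy.RungEtale.Etale
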